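import Summits.BirchSwinnertonDyer.BirchSwinnertonDyer.Theorems.AdditiveKolyvaginRoadSwitchedLevelDescent
import Summits.BirchSwinnertonDyer.BirchSwinnertonDyer.Theorems.AdditiveKolyvaginRoadSwitchedEigen
import Summits.BirchSwinnertonDyer.BirchSwinnertonDyer.Theorems.AdditiveKolyvaginRoadSwitchedBridge
import Summits.BirchSwinnertonDyer.BirchSwinnertonDyer.Theorems.AdditiveKolyvaginRoadLagrangianSwitchAtPDouble
import Summits.BirchSwinnertonDyer.BirchSwinnertonDyer.Theorems.SchneiderFreeAdditiveX3PoitouTateSelmerDualityHolds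
import HarnessLib

/-!
# Route `AdditiveKolyvaginRoad`, crux KS′ `LevelKolyvaginSystemsAdditive` (stmt-BirchSwinnertonDyer-21396) ∕ KPA′ (stmt-BirchSwinnertonDyer-21400):
# SWITCHED CANONICAL SPACES, part 9 — ASSEMBLY: the switched level descent reaches a level of ODD size iff E's `p`-Selmer dimension over `K` is odd
# (the stub T2 «FL-engine» of the crux card `irred-vertex-anchor`, E-side, COMPLETE modulo E's `p`-Selmer parity = stub P of 21400)
# (cell `pub/bsd-wall`, width seat `bsd-wall-akr-p2x-w3` g10; `--supports stmt-BirchSwinnertonDyer-21396`, helper; E-side glue; assembles this seat's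
# `…Switched{Iso,RankLowering,LevelDescent,Eigen,Bridge}.lean` and `…LagrangianSwitchAtP{GeneralBase,Double}.lean` at the PROVED Poitou–Tate fact)

WHY. The crux-ideate card `Cruxes/LevelKolyvaginSystemsAdditive/Ideas/irred-vertex-anchor.md` (r1 seat 2 g16) proposes, on the potentially
supersingular additive cells, to run the `E[p]`-rank-lowering in the Selmer structure `𝓕_T` — E's Kummer conditions away from `p`, the Fontaine–Laffaille
LINES `L_T, L̄_T` of the T-good companion at the two places above the split `p` — down to an ODD vertex `n₀` with `Sel_{𝓕_T,(n₀)}(K, E[p]) = 0`, where a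
printed p-GOOD rank-0 anchor (Wan ∕ Kim–Ota) fires (stub T2, «theorem-grade M», E-side). This file is T2 in the kernel, for ANY pair of Lagrangian lines:
the descent exists unconditionally (parts 1–3) and its length has the parity of E's `p`-Selmer dimension over `K` (parts 4–8: eigen-sum for the
`c`-stable switched group, bridge to Selmer structures, two one-place Lagrangian switches each moving the order by exactly `p`). What T2 still
imports is E's `p`-Selmer PARITY at a ♯ frame (`#Sel_p(E/K) = p^s`, `s` odd) — stub P of crux r2 KPA′ (PUB-shaped: Gross–Zagier–Kolyvagin +
Cassels–Tate, or `p`-parity) — and the card's companion side (T1 dictionary, T3 Wan, T4 Kim–Ota, T5 exact control) is untouched.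

WHAT (namespace `…Theorems.AdditiveKoly`). **`exists_level_switched_eq_bot_card_odd_iff`** — frame `p ≥ 5`, `p ∣ N_E`, `ρ̄_{E,p}` onto, `K` imaginary
quadratic with the Heegner hypothesis, `c ≠ 1`, `c² = 1`; `𝔭 ≠ 𝔭'` the places above `p` (binder `honly`), both planes (`#H¹(K_𝔭, E[p]) = p²`); `L`, `L'`
isotropic for the local Weil cup product of every Weil datum, `≠ 0`, `≠` E's Kummer conditions; the switched condition `Λ = loc_𝔭⁻¹ L ⊓ loc_{𝔭'}⁻¹ L'`
(written as part 5's `Λ_𝓕`, `𝓕 = 𝓚[𝔭 ↦ L][𝔭' ↦ L']`, `T = {p}`) `c`-stable; `#Sel_p(E/K) = p^s`. THEN `∃ n₀` (finite set of Bertolini–Darmon admissible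
primes) with the switched canonical spaces of both signs ZERO at `n₀` and `Odd #n₀ ↔ Odd s`.

HONEST FRAMING: one theorem; 0 definitions, 0 named facts, 0 `sorry`; standard axioms; hypotheses displayed (`c`-stability of `Λ` — for conjugate
Lagrangian lines, their transport under `c` —, the plane counts — `E(K_𝔭)[p] = 0`, `natCard_localH1_eq_sq` —, and the exclusion of the mixed case
`L = 𝓚_𝔭` are the consumer's). E-side glue; closes nothing. BSD is not proved by any of this; KS′ ∕ KPA′ stay OPEN.

References: [cite: WZhang2014, Prop. 5.4, Lemma 7.3, §9] [cite: BertoliniDarmon2005, Lemma 2.6, Thm. 3.2] [cite: PoonenRains2012, Prop. 4.10, Prop. 4.11]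
[cite: MilneADT2006, Ch. I, Cor. 2.3, Thm. 2.8, Thm. 4.10] [cite: GrossLMS1991, §5 (5.1), §10].
-/

-- single-conjunct summit: `Summit.BirchSwinnertonDyer.BirchSwinnertonDyer.…` repeats the name by design
set_option linter.dupNamespace false

noncomputable section

open scoped Classical

namespace Summit.BirchSwinnertonDyer.BirchSwinnertonDyer.Theorems.AdditiveKoly

open CategoryTheory WeierstrassCurve Field Function NumberField IsDedekindDomain
open Literature.NumberTheory.EllipticCurves Literature.NumberTheory.EllipticCurves.ModularForms
  Literature.NumberTheory.EllipticCurves.Rank1Residual Literature.NumberTheory.GaloisRepresentations Module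
open Literature.NumberTheory.GaloisRepresentations.DiscreteGaloisModule
open Literature.NumberTheory.GaloisCohomology
open Summit.BirchSwinnertonDyer.Rank1Residual.X11b Summit.BirchSwinnertonDyer.Rank1Residual.X11b.Relaxation
open Summit.BirchSwinnertonDyer.BirchSwinnertonDyer.Theorems.SchneiderFreeAdditiveX3.PoitouTateReduction
  (poitouTate_selmerStructure_duality_holds)
open scoped ContRepresentation

section Assembly

variable (W : WeierstrassCurve ℚ) (K : Type) [Field K] [NumberField K] (p : ℕ) (c : K ≃ₐ[ℚ] K)
variable [W.IsElliptic] [W.IsGloballyMinimal] [Fact p.Prime] [Module (ZMod p) (Vp W K p)]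
  [∀ v : Place K, CompactSpace (absoluteGaloisGroup (Place.Completion v))]

/-- **THE «FL-ENGINE» WITH ITS PARITY LEG (card `irred-vertex-anchor`, stub T2 — E-side, modulo E's `p`-Selmer parity).** Frame: `p ≥ 5`,
`p ∣ N_E`, `ρ̄_{E,p}` onto, `K` imaginary quadratic with the Heegner hypothesis for `N_E`, complex conjugation `c` (`c ≠ 1`, `c² = 1`); `p` SPLIT in
`K` with places `𝔭 ≠ 𝔭'` (the only places above `p`), both PLANES (`#H¹(K_𝔭, E[p]) = p²`, i.e. `E(K_𝔭)[p] = 0`); two local conditions `L` at `𝔭`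
and `L'` at `𝔭'` — isotropic for the local Weil cup product of every Weil datum, non-zero, and different from E's Kummer conditions (e.g. the
Fontaine–Laffaille lines of a congruent companion form) — such that the resulting switched condition
`Λ = loc_𝔭⁻¹ L ⊓ loc_{𝔭'}⁻¹ L'` (written as the `T = {p}` instance of part 5's `Λ_𝓕`, `𝓕 = 𝓚[𝔭 ↦ L][𝔭' ↦ L']`) is `c`-stable. If E's `p`-Selmer group
over `K` has order `p^s`, then there is a finite set `n₀` of Bertolini–Darmon admissible primes at which the SWITCHED canonical spaces of both signs
vanish, and `#n₀` is ODD iff `s` is. Assembly of: the switched level descent (`exists_level_switched_eq_bot_at_p`), the eigen-sum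
(`finrank_switched_empty_eq_eigen_add`), the bridge (`switchedTotal_eq_selmerGroup`), the double switch
(`natCard_selmerGroup_double_switch_of_poitouTate` at the PROVED Poitou–Tate fact), and `Sel_p(E/K) = H¹_𝓚` (`selmerGroup_eq_selmerGroup_kummerSelmerStructure`).
At a ♯ frame `s` is odd (stub P of crux r2 KPA′, PUB-shaped), so `#n₀` is odd: the definite vertex the card's companion-side anchor wants.
[cite: WZhang2014, Prop. 5.4, Lemma 7.3, §9] [cite: BertoliniDarmon2005, Thm. 3.2] [cite: PoonenRains2012, Prop. 4.10, Prop. 4.11]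
[cite: MilneADT2006, Ch. I, Thm. 4.10] [cite: GrossLMS1991, §5 (5.1), §10] -/
theorem exists_level_switched_eq_bot_card_odd_iff (h5 : 5 ≤ p) (hpN : p ∣ W.conductorNorm ℤ)
    (hsurj : W.HasSurjectiveModNGaloisRep p) (hK : IsImaginaryQuadratic K) (hH : SatisfiesHeegnerHypothesis (W.conductorNorm ℤ) K)
    (hc1 : c ≠ 1) (hcc : c * c = 1)
    (𝔭 𝔭' : HeightOneSpectrum (𝓞 K)) (hne : 𝔭 ≠ 𝔭')
    (honly : ∀ v : HeightOneSpectrum (𝓞 K), (p : 𝓞 K) ∈ v.asIdeal → v = 𝔭 ∨ v = 𝔭')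
    (h𝔭 : (p : 𝓞 K) ∈ 𝔭.asIdeal) (h𝔭' : (p : 𝓞 K) ∈ 𝔭'.asIdeal)
    (hH₁ : Nat.card (galoisCohomology (((W.baseChange K).torsionGaloisModule ((p ^ 1 : ℕ) : ℤ)).toLocal (Sum.inr 𝔭 : Place K)) 1) = p ^ 2)
    (hH₂ : Nat.card (galoisCohomology (((W.baseChange K).torsionGaloisModule ((p ^ 1 : ℕ) : ℤ)).toLocal (Sum.inr 𝔭' : Place K)) 1) = p ^ 2)
    (L : AddSubgroup (galoisCohomology (((W.baseChange K).torsionGaloisModule ((p ^ 1 : ℕ) : ℤ)).toLocal (Sum.inr 𝔭 : Place K)) 1))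
    (L' : AddSubgroup (galoisCohomology (((W.baseChange K).torsionGaloisModule ((p ^ 1 : ℕ) : ℤ)).toLocal (Sum.inr 𝔭' : Place K)) 1))
    (hLiso : ∀ (e : geomTorsion (W.baseChange K) ((p ^ 1 : ℕ) : ℤ) → geomTorsion (W.baseChange K) ((p ^ 1 : ℕ) : ℤ) →
        AlgebraicClosure K)
      (hμ : ∀ S T, e S T ^ (p ^ 1) = 1)
      (hadd₁ : ∀ S₁ S₂ T, e (S₁ + S₂) T = e S₁ T * e S₂ T)
      (hadd₂ : ∀ S T₁ T₂, e S (T₁ + T₂) = e S T₁ * e S T₂)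
      (hgal : ∀ (σ : absoluteGaloisGroup K) (S T : geomTorsion (W.baseChange K) ((p ^ 1 : ℕ) : ℤ)),
        σ • e S T = e (σ • S) (σ • T)),
      ∀ a ∈ L, ∀ b ∈ L, (weilContPairingLocal (W.baseChange K) (p ^ 1) e hμ hadd₁ hadd₂ hgal (Sum.inr 𝔭)).cupProduct a b = 0)
    (hL'iso : ∀ (e : geomTorsion (W.baseChange K) ((p ^ 1 : ℕ) : ℤ) → geomTorsion (W.baseChange K) ((p ^ 1 : ℕ) : ℤ) →
        AlgebraicClosure K)
      (hμ : ∀ S T, e S T ^ (p ^ 1) = 1)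
      (hadd₁ : ∀ S₁ S₂ T, e (S₁ + S₂) T = e S₁ T * e S₂ T)
      (hadd₂ : ∀ S T₁ T₂, e S (T₁ + T₂) = e S T₁ * e S T₂)
      (hgal : ∀ (σ : absoluteGaloisGroup K) (S T : geomTorsion (W.baseChange K) ((p ^ 1 : ℕ) : ℤ)),
        σ • e S T = e (σ • S) (σ • T)),
      ∀ a ∈ L', ∀ b ∈ L', (weilContPairingLocal (W.baseChange K) (p ^ 1) e hμ hadd₁ hadd₂ hgal (Sum.inr 𝔭')).cupProduct a b = 0)
    (hL0 : L ≠ ⊥) (hL'0 : L' ≠ ⊥)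
    (hLK : L ≠ (W.baseChange K).kummerSelmerStructure ((p ^ 1 : ℕ) : ℤ) (Sum.inr 𝔭))
    (hL'K : L' ≠ (W.baseChange K).kummerSelmerStructure ((p ^ 1 : ℕ) : ℤ) (Sum.inr 𝔭'))
    (hΛc : ∀ x ∈ (⨅ (v : HeightOneSpectrum (𝓞 K)) (_ : ∃ t ∈ ({p} : Set ℕ), (t : 𝓞 K) ∈ v.asIdeal),
        ((Function.update (Function.update ((W.baseChange K).kummerSelmerStructure ((p ^ 1 : ℕ) : ℤ))
            (Sum.inr 𝔭 : Place K) L : SelmerStructure ((W.baseChange K).torsionGaloisModule ((p ^ 1 : ℕ) : ℤ)))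
            (Sum.inr 𝔭' : Place K) L') (Sum.inr v)).comap
          (galoisCohomology.localization ((W.baseChange K).torsionGaloisModule ((p ^ 1 : ℕ) : ℤ)) (Sum.inr v) 1)),
      conjAct W c ((p ^ 1 : ℕ) : ℤ) x ∈
        (⨅ (v : HeightOneSpectrum (𝓞 K)) (_ : ∃ t ∈ ({p} : Set ℕ), (t : 𝓞 K) ∈ v.asIdeal),
        ((Function.update (Function.update ((W.baseChange K).kummerSelmerStructure ((p ^ 1 : ℕ) : ℤ))
            (Sum.inr 𝔭 : Place K) L : SelmerStructure ((W.baseChange K).torsionGaloisModule ((p ^ 1 : ℕ) : ℤ)))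
            (Sum.inr 𝔭' : Place K) L') (Sum.inr v)).comap
          (galoisCohomology.localization ((W.baseChange K).torsionGaloisModule ((p ^ 1 : ℕ) : ℤ)) (Sum.inr v) 1)))
    (s : ℕ) (hs : Nat.card (selmerGroup (W.baseChange K) ((p ^ 1 : ℕ) : ℤ)) = p ^ s) :
    ∃ n₀ : Finset (AdmQ W K p),
      (∀ μ, AddSubgroup.toZModSubmodule p (levelSelmerSubgroupP W K p c (n₀.image Subtype.val) {p} μ ⊓
        (⨅ (v : HeightOneSpectrum (𝓞 K)) (_ : ∃ t ∈ ({p} : Set ℕ), (t : 𝓞 K) ∈ v.asIdeal),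
          ((Function.update (Function.update ((W.baseChange K).kummerSelmerStructure ((p ^ 1 : ℕ) : ℤ))
              (Sum.inr 𝔭 : Place K) L : SelmerStructure ((W.baseChange K).torsionGaloisModule ((p ^ 1 : ℕ) : ℤ)))
              (Sum.inr 𝔭' : Place K) L') (Sum.inr v)).comap
            (galoisCohomology.localization ((W.baseChange K).torsionGaloisModule ((p ^ 1 : ℕ) : ℤ)) (Sum.inr v) 1))) = ⊥) ∧
      (Odd n₀.card ↔ Odd s) := by
  have hp : p.Prime := Fact.out
  have hp2 : p ≠ 2 := by omega
  haveI : NeZero (p ^ 1 : ℕ) := ⟨pow_ne_zero 1 hp.ne_zero⟩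
  haveI : PerfectField K := PerfectField.ofCharZero
  haveI : Finite (geomTorsion (W.baseChange K) ((p ^ 1 : ℕ) : ℤ)) := finite_geomTorsion_of_neZero (W.baseChange K) (p ^ 1)
  -- names
  set 𝓚 : SelmerStructure ((W.baseChange K).torsionGaloisModule ((p ^ 1 : ℕ) : ℤ)) :=
    (W.baseChange K).kummerSelmerStructure ((p ^ 1 : ℕ) : ℤ) with h𝓚
  set 𝓕 : SelmerStructure ((W.baseChange K).torsionGaloisModule ((p ^ 1 : ℕ) : ℤ)) :=
    Function.update (Function.update 𝓚 (Sum.inr 𝔭 : Place K) L) (Sum.inr 𝔭' : Place K) L' with h𝓕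
  set Λ : AddSubgroup (Vp W K p) :=
    ⨅ (v : HeightOneSpectrum (𝓞 K)) (_ : ∃ t ∈ ({p} : Set ℕ), (t : 𝓞 K) ∈ v.asIdeal),
      (𝓕 (Sum.inr v)).comap (galoisCohomology.localization ((W.baseChange K).torsionGaloisModule ((p ^ 1 : ℕ) : ℤ)) (Sum.inr v) 1)
    with hΛ
  have hne' : (Sum.inr 𝔭 : Place K) ≠ Sum.inr 𝔭' := fun h ↦ hne (Sum.inr_injective h)
  have h𝓕𝔭 : 𝓕 (Sum.inr 𝔭) = L := by
    rw [h𝓕, Function.update_of_ne hne', Function.update_self]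
  have h𝓕𝔭' : 𝓕 (Sum.inr 𝔭') = L' := by
    rw [h𝓕, Function.update_self]
  -- the local conditions of `𝓕` above `p` are isotropic for every Weil datum
  have h𝓕iso : ∀ (e : geomTorsion (W.baseChange K) ((p ^ 1 : ℕ) : ℤ) → geomTorsion (W.baseChange K) ((p ^ 1 : ℕ) : ℤ) →
        AlgebraicClosure K)
      (hμ : ∀ S T, e S T ^ (p ^ 1) = 1)
      (hadd₁ : ∀ S₁ S₂ T, e (S₁ + S₂) T = e S₁ T * e S₂ T)
      (hadd₂ : ∀ S T₁ T₂, e S (T₁ + T₂) = e S T₁ * e S T₂)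
      (hgal : ∀ (σ : absoluteGaloisGroup K) (S T : geomTorsion (W.baseChange K) ((p ^ 1 : ℕ) : ℤ)),
        σ • e S T = e (σ • S) (σ • T)),
      ∀ v : HeightOneSpectrum (𝓞 K), (∃ t ∈ ({p} : Set ℕ), (t : 𝓞 K) ∈ v.asIdeal) →
      ∀ a ∈ 𝓕 (Sum.inr v), ∀ b ∈ 𝓕 (Sum.inr v),
        (weilContPairingLocal (W.baseChange K) (p ^ 1) e hμ hadd₁ hadd₂ hgal (Sum.inr v)).cupProduct a b = 0 := by
    intro e hμ hadd₁ hadd₂ hgal v hv a ha b hb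
    obtain ⟨t, ht, htv⟩ := hv
    rw [Set.mem_singleton_iff] at ht
    subst ht
    rcases honly v htv with rfl | rfl
    · rw [h𝓕𝔭] at ha hb
      exact hLiso e hμ hadd₁ hadd₂ hgal a ha b hb
    · rw [h𝓕𝔭'] at ha hb
      exact hL'iso e hμ hadd₁ hadd₂ hgal a ha b hb
  -- (1) the switched level descent
  have hΛiso := switched_isotropy_of_selmerStructure W K p ({p} : Set ℕ) 𝓕
  obtain ⟨n₀, hn₀, hcard⟩ := exists_level_switched_eq_bot_at_p W K p c h5 hpN hsurj hK hH hc1 Λ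
    (fun e hμ hadd₁ hadd₂ hgal w hw y hy z hz ↦ hΛiso e hμ hadd₁ hadd₂ hgal (h𝓕iso e hμ hadd₁ hadd₂ hgal) p
      (Set.mem_singleton p) w hw y hy z hz)
  refine ⟨n₀, hn₀, ?_⟩
  -- (2) the eigen-sum: `#n₀ = dim D`
  have hKc : ∀ w : InfinitePlace K, w.IsComplex := fun w ↦ hK.2.isComplex w
  have hp0 : (0 : ℕ) ∉ ({p} : Set ℕ) := by
    rw [Set.mem_singleton_iff]
    exact hp.ne_zero.symm
  have heigen := finrank_switched_empty_eq_eigen_add W K p c hp2 hKc hcc {p} (Set.finite_singleton p) hp0 Λ hΛc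
  rw [← heigen] at hcard
  -- (3) the bridge: `D = H¹_𝓕`
  have hinf : ∀ w : InfinitePlace K, 𝓕 (Sum.inl w) = 𝓚 (Sum.inl w) := fun w ↦ by
    rw [h𝓕, Function.update_of_ne Sum.inl_ne_inr, Function.update_of_ne Sum.inl_ne_inr]
  have hfin : ∀ v : HeightOneSpectrum (𝓞 K), (∀ t ∈ ({p} : Set ℕ), (t : 𝓞 K) ∉ v.asIdeal) → 𝓕 (Sum.inr v) = 𝓚 (Sum.inr v) := by
    intro v hv
    have hv𝔭 : (Sum.inr v : Place K) ≠ Sum.inr 𝔭 := fun h ↦ hv p (Set.mem_singleton p) (by rw [Sum.inr_injective h]; exact h𝔭)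
    have hv𝔭' : (Sum.inr v : Place K) ≠ Sum.inr 𝔭' := fun h ↦
      hv p (Set.mem_singleton p) (by rw [Sum.inr_injective h]; exact h𝔭')
    rw [h𝓕, Function.update_of_ne hv𝔭', Function.update_of_ne hv𝔭]
  have hbridge := switchedTotal_eq_selmerGroup W K p ({p} : Set ℕ) 𝓕 hinf hfin
  -- (4) the double switch at the proved Poitou–Tate fact
  have hdouble := LagrangianSwitchAtP.natCard_selmerGroup_double_switch_of_poitouTate (W.baseChange K) p hp2
    (poitouTate_selmerStructure_duality_holds K) 𝔭 𝔭' hne hH₁ hH₂ L L'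
    (fun inv e hμ hadd₁ hadd₂ hgal _ _ _ x hx y hy ↦ by
      rw [invWeilPairing_apply, hLiso e hμ hadd₁ hadd₂ hgal x hx y hy]
      exact map_zero _)
    (fun inv e hμ hadd₁ hadd₂ hgal _ _ _ x hx y hy ↦ by
      rw [invWeilPairing_apply, hL'iso e hμ hadd₁ hadd₂ hgal x hx y hy]
      exact map_zero _)
    hL0 hL'0 hLK hL'K
  have hs' : Nat.card 𝓚.selmerGroup = p ^ s := by
    rw [h𝓚, ← selmerGroup_eq_selmerGroup_kummerSelmerStructure]
    exact hs
  obtain ⟨b, hb, hsb⟩ := LagrangianSwitchAtP.exists_pow_and_even_iff_of_double_switch p hdouble hs'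
  -- (5) `#n₀ = b`
  have hDcard : Nat.card
      ((((⨅ (w : InfinitePlace K), selmerLocalKer (W.baseChange K) w.Completion ((p ^ 1 : ℕ) : ℤ)) ⊓
        (⨅ (v : HeightOneSpectrum (𝓞 K)) (_ : ∀ t ∈ ({p} : Set ℕ), (t : 𝓞 K) ∉ v.asIdeal),
          selmerLocalKer (W.baseChange K) (v.adicCompletion K) ((p ^ 1 : ℕ) : ℤ))) ⊓ Λ : AddSubgroup (Vp W K p))) = p ^ b := by
    rw [hΛ, hbridge]
    exact hb
  set D : AddSubgroup (Vp W K p) :=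
    ((⨅ (w : InfinitePlace K), selmerLocalKer (W.baseChange K) w.Completion ((p ^ 1 : ℕ) : ℤ)) ⊓
      (⨅ (v : HeightOneSpectrum (𝓞 K)) (_ : ∀ t ∈ ({p} : Set ℕ), (t : 𝓞 K) ∉ v.asIdeal),
        selmerLocalKer (W.baseChange K) (v.adicCompletion K) ((p ^ 1 : ℕ) : ℤ))) ⊓ Λ with hD
  haveI : Finite D := Nat.finite_of_card_ne_zero (by rw [hDcard]; exact pow_ne_zero b hp.ne_zero)
  haveI : Finite (AddSubgroup.toZModSubmodule p D) :=
    Finite.of_equiv _ (Equiv.setCongr (AddSubgroup.coe_toZModSubmodule p _).symm)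
  haveI : Module.Finite (ZMod p) (AddSubgroup.toZModSubmodule p D) := Module.Finite.of_finite
  have hpow : p ^ finrank (ZMod p) (AddSubgroup.toZModSubmodule p D) = p ^ b := by
    rw [pow_finrank_eq_natCard, ← hDcard]
    exact Nat.card_congr (Equiv.setCongr (AddSubgroup.coe_toZModSubmodule p D))
  have hnb : n₀.card = b := by
    rw [hcard]
    exact Nat.pow_right_injective hp.two_le hpow
  rw [hnb, ← Nat.not_even_iff_odd, ← Nat.not_even_iff_odd, hsb]

end Assembly

end Summit.BirchSwinnertonDyer.BirchSwinnertonDyer.Theorems.AdditiveKoly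

end
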